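import Literature.Geometry.Lorentzian.TracedGaussEquation
import HarnessLib

/-!
# The traced Gauss equation of a hypersurface, in every dimension

`TracedGaussEquation.lean` proves the twice-traced Gauss equation for surfaces in
three-manifolds. Here the same identity is proved for a spacelike immersed hypersurface
`f : (Nᵐ, f^*g) → (Mᵐ⁺¹, g)` of any dimension with a unit normal field `ν` of sign `ε ≠ 0`
(O'Neill 1983, Ch. 4, Thm. 5 and its Corollary, traced twice):

  `S_{f^*g} = S_g − 2 Ric_g(ν, ν)/ε + (H² − |K|²_{f^*g})/ε`,

`S` the scalar curvatures, `H = tr_{f^*g} K` the (unnormalised) mean curvature and `|K|²` the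
metric square norm of the second fundamental form `K = secondFundamentalForm` (sign convention
`K_ν(v,w) = g(D_v ν, df w)` of the tree). This is the traced Gauss equation entering, together
with the Riccati equation for the level sets of the distance to the boundary, the formula
`scal_g = scal_{g_t} + 3 tr(W_t²) − tr(W_t)² − tr_{g_t}(g̈_t)` for a metric in geodesic collar
coordinates (Bär–Gauduchon–Moroianu 2005, Prop. 4.1; Bär–Hanke 2023, §3, (9)), layer L2 of the
proof programme of `Literature.Geometry.Riemannian.BaerHankePscGluing`.

* `ricci_eq_sum_of_isOrthoᵢ`, `scalarCurvature_eq_sum_of_isOrthoᵢ` — `Ric` and `S` in an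
  orthogonal frame of non-null vectors: `Ric(Y,Z) = ∑ᵢ g(R(βᵢ,Y)Z, βᵢ)/aᵢ`,
  `S = ∑ₖ ∑ᵢ g(R(βᵢ,βₖ)βₖ, βᵢ)/(aᵢ aₖ)` (`aᵢ = g(βᵢ, βᵢ)`; O'Neill 1983, Ch. 3, Lemma 3.52,
  Def. 3.53);
* `scalarCurvature_sub_ricci_eq_sum_of_isOrthoᵢ` — in an orthogonal frame `(γ₀,…,γₘ₋₁, γₘ = ν)`,
  `S − 2 Ric(ν,ν)/g(ν,ν)` is the double sum of the sectional terms over the first `m` vectors;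
* `scalarCurvature_inducedMetric_eq_general` — **the traced Gauss equation** in dimension
  `m ⊂ m + 1`, every `m`; `scalarCurvature_eq_of_inducedMetric_general` — its Riemannian form
  (`ε = 1`) solved for `S_g`.

Everything is proved; there are no definitions and no named facts.

## References

* B. O'Neill, *Semi-Riemannian geometry with applications to relativity*, Academic Press 1983,
  Ch. 3, Prop. 3.36, Lemma 3.52, Def. 3.53; Ch. 4, Thm. 5 and Corollary (p. 100). [ONeill1983]
* C. Bär, B. Hanke, *Boundary conditions for scalar curvature*, arXiv:2012.09127, §3, (9).
  [BarHanke2023]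
-/

noncomputable section

open Bundle Set Filter Function Manifold
open scoped Manifold ContDiff Topology

namespace Literature.Geometry.Lorentzian

namespace PseudoRiemannianMetric

variable {E : Type*} [NormedAddCommGroup E] [NormedSpace ℝ E] {H : Type*} [TopologicalSpace H]
  {I : ModelWithCorners ℝ E H} {M : Type*} [TopologicalSpace M] [ChartedSpace H M]
  [IsManifold I ∞ M] [FiniteDimensional ℝ E] [CompleteSpace E]
  (g : PseudoRiemannianMetric I ∞ E (TangentSpace I : M → Type _)) [g.HasLeviCivita]

/-! ### Ricci and scalar curvature in an orthogonal frame -/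

omit [CompleteSpace E] in
/-- **The Ricci tensor in an orthogonal frame**: for a `g_x`-orthogonal basis `β` of non-null
vectors, `Ric_x(Y, Z) = ∑ᵢ g(R(βᵢ, Y) Z, βᵢ) / g(βᵢ, βᵢ)` (O'Neill 1983, Ch. 3, Lemma 3.52, with
the diagonal inverse Gram matrix `gram_inv_of_isOrthoᵢ`). [cite: ONeill1983, Ch. 3, Lemma 3.52] -/
theorem ricci_eq_sum_of_isOrthoᵢ {ι : Type*} [Fintype ι] [DecidableEq ι] (x : M)
    (β : Module.Basis ι ℝ (TangentSpace I x)) (hβ : (g.toBilinForm x).IsOrthoᵢ β)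
    (hd : ∀ i, g.val x (β i) (β i) ≠ 0) (Y₀ Z₀ : TangentSpace I x) :
    g.ricci x Y₀ Z₀ = ∑ i, g.val x (g.riemann x (β i) Y₀ Z₀) (β i) / g.val x (β i) (β i) := by
  rw [ricci_eq_sum g x β, gram_inv_of_isOrthoᵢ g x β hβ hd]
  refine Finset.sum_congr rfl fun i _ ↦ ?_
  rw [Finset.sum_eq_single i]
  · rw [Matrix.diagonal_apply_eq, inv_mul_eq_div]
  · intro j _ hji
    rw [Matrix.diagonal_apply_ne _ hji, zero_mul]
  · intro h
    exact absurd (Finset.mem_univ i) h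

omit [CompleteSpace E] in
/-- **The scalar curvature in an orthogonal frame**: for a `g_x`-orthogonal basis `β` of
non-null vectors, `S(x) = ∑ₖ ∑ᵢ g(R(βᵢ, βₖ) βₖ, βᵢ) / (g(βᵢ,βᵢ) g(βₖ,βₖ))` — the sum of the
sectional terms over ordered pairs (O'Neill 1983, Ch. 3, Def. 3.53 with Lemma 3.52).
[cite: ONeill1983, Ch. 3, Def. 3.53] -/
theorem scalarCurvature_eq_sum_of_isOrthoᵢ {ι : Type*} [Fintype ι] [DecidableEq ι] (x : M)
    (β : Module.Basis ι ℝ (TangentSpace I x)) (hβ : (g.toBilinForm x).IsOrthoᵢ β)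
    (hd : ∀ i, g.val x (β i) (β i) ≠ 0) :
    g.scalarCurvature x = ∑ k, ∑ i, g.val x (g.riemann x (β i) (β k) (β k)) (β i) /
      (g.val x (β i) (β i) * g.val x (β k) (β k)) := by
  rw [scalarCurvature_eq_sum g x β, gram_inv_of_isOrthoᵢ g x β hβ hd]
  refine Finset.sum_congr rfl fun k _ ↦ ?_
  rw [Finset.sum_eq_single k]
  · rw [Matrix.diagonal_apply_eq, ricci_eq_sum_of_isOrthoᵢ g x β hβ hd, Finset.mul_sum]
    refine Finset.sum_congr rfl fun i _ ↦ ?_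
    rw [inv_mul_eq_div, div_div]
  · intro l _ hlk
    rw [Matrix.diagonal_apply_ne _ hlk, zero_mul]
  · intro h
    exact absurd (Finset.mem_univ k) h

omit [CompleteSpace E] in
/-- **Scalar curvature minus twice the normal Ricci curvature, in an adapted orthogonal frame**
(every dimension): for a `g_x`-orthogonal basis `γ₀, …, γₘ` of non-null vectors with
distinguished last vector `ν = γₘ`,
`S(x) − 2 Ric(ν, ν)/g(ν,ν) = ∑ₖ ∑ᵢ g(R(γᵢ, γₖ) γₖ, γᵢ)/(aᵢ aₖ)` summed over `i, k < m`: the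
sectional terms through `ν` occur twice in `S` and make up `2 Ric(ν,ν)/g(ν,ν)` (pair symmetry
and antisymmetry of `R`, O'Neill 1983, Ch. 3, Prop. 3.36; Lemma 3.52, Def. 3.53).
[cite: ONeill1983, Ch. 3, Lemma 3.52 and Def. 3.53] -/
theorem scalarCurvature_sub_ricci_eq_sum_of_isOrthoᵢ {m : ℕ} (x : M)
    (γ : Module.Basis (Fin (m + 1)) ℝ (TangentSpace I x)) (hγ : (g.toBilinForm x).IsOrthoᵢ γ)
    (hd : ∀ i, g.val x (γ i) (γ i) ≠ 0) :
    g.scalarCurvature x - 2 * g.ricci x (γ (Fin.last m)) (γ (Fin.last m)) /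
        g.val x (γ (Fin.last m)) (γ (Fin.last m)) =
      ∑ k : Fin m, ∑ i : Fin m,
        g.val x (g.riemann x (γ i.castSucc) (γ k.castSucc) (γ k.castSucc)) (γ i.castSucc) /
          (g.val x (γ i.castSucc) (γ i.castSucc) * g.val x (γ k.castSucc) (γ k.castSucc)) := by
  set ν := γ (Fin.last m) with hν
  set ε := g.val x ν ν with hε
  have hε0 : ε ≠ 0 := hd (Fin.last m)
  -- the terms through `ν`
  set Z : Fin m → ℝ := fun i ↦
    g.val x (g.riemann x (γ i.castSucc) ν ν) (γ i.castSucc) / g.val x (γ i.castSucc) (γ i.castSucc)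
    with hZ
  have hRic : g.ricci x ν ν = ∑ i, Z i := by
    rw [ricci_eq_sum_of_isOrthoᵢ g x γ hγ hd, Fin.sum_univ_castSucc, val_riemann_self₁₂,
      zero_div, add_zero]
  have hS : g.scalarCurvature x =
      (∑ k : Fin m, ∑ i : Fin m,
        g.val x (g.riemann x (γ i.castSucc) (γ k.castSucc) (γ k.castSucc)) (γ i.castSucc) /
          (g.val x (γ i.castSucc) (γ i.castSucc) * g.val x (γ k.castSucc) (γ k.castSucc))) +
      (∑ k, Z k / ε) + (∑ i, Z i / ε) := by
    rw [scalarCurvature_eq_sum_of_isOrthoᵢ g x γ hγ hd, Fin.sum_univ_castSucc]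
    simp only [Fin.sum_univ_castSucc, val_riemann_self₁₂, zero_div, add_zero]
    rw [Finset.sum_add_distrib]
    congr 1
    · congr 1
      refine Finset.sum_congr rfl fun k _ ↦ ?_
      rw [hZ, val_riemann_swap g x (γ k.castSucc) ν]
      simp only
      rw [div_div, mul_comm ε]
    · refine Finset.sum_congr rfl fun i _ ↦ ?_
      simp only [hZ]
      rw [div_div]
  rw [hS, hRic, ← Finset.sum_div]
  field_simp
  ring

/-! ### The traced Gauss equation in every dimension -/

section Traced

variable {E' : Type*} [NormedAddCommGroup E'] [NormedSpace ℝ E'] {H' : Type*} [TopologicalSpace H']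
  {I' : ModelWithCorners ℝ E' H'} {N : Type*} [TopologicalSpace N] [ChartedSpace H' N]
  [IsManifold I' ∞ N] [FiniteDimensional ℝ E'] [CompleteSpace E'] [I'.Boundaryless] {f : N → M}
  (hpb : contMDiff_pullbackBilin I M I' N ∞) (hfi : g.IsSpacelikeImmersion I' f)
  {ν : NormalField I f} {ε : ℝ}

/-- **The traced Gauss equation of an immersed hypersurface, every dimension** (O'Neill 1983,
Ch. 4, Thm. 5 and its Corollary, traced twice). For a smooth spacelike immersion
`f : (Nᵐ, f^*g) → (Mᵐ⁺¹, g)` with unit normal field `ν` of sign `ε ≠ 0` (smooth lift) and every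
`y₀`:  `S_{f^*g}(y₀) = S_g(f y₀) − 2 Ric_g(ν, ν)/ε + (H² − |K|²_{f^*g})/ε`, where `S` are the
scalar curvatures, `H = tr_{f^*g} K` the mean curvature and `|K|²` the square norm of the second
fundamental form `K`. Proof: in an `(f^*g)`-orthogonal basis `β` of `T_{y₀}N`
(`exists_isOrthoᵢ_basis`), `S_{f^*g}` is the double sum of sectional terms
(`scalarCurvature_eq_sum_of_isOrthoᵢ`); in the `g`-orthogonal basis `(df β₀, …, df βₘ₋₁, ν)` of
`T_{f y₀}M`, `S_g − 2Ric(ν,ν)/ε` is the corresponding double sum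
(`scalarCurvature_sub_ricci_eq_sum_of_isOrthoᵢ`); the Gauss equation on each pair
(`gauss_equation_localFrame`) links the two, and `H = ∑ Kᵢᵢ/aᵢ`, `|K|² = ∑ Kᵢⱼ²/(aᵢaⱼ)`
(`normSq_eq_sum_sq`, `K` symmetric). [cite: ONeill1983, Ch. 4, Thm. 5 and Corollary] -/
theorem scalarCurvature_inducedMetric_eq_general
    (hν : ContMDiff I' I.tangent ∞ (fun x ↦ (TotalSpace.mk' E (f x) (ν x) : TangentBundle I M)))
    (hun : g.IsUnitNormal I' f ν ε) (hε : ε ≠ 0) {m : ℕ}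
    (hm : Module.finrank ℝ E' = m) (hm1 : Module.finrank ℝ E = m + 1) (y₀ : N) :
    haveI := (g.inducedMetric f hpb hfi).hasLeviCivita
    (g.inducedMetric f hpb hfi).scalarCurvature y₀ =
      g.scalarCurvature (f y₀) - 2 * g.ricci (f y₀) (ν y₀) (ν y₀) / ε +
      (g.meanCurvature f hpb hfi ν y₀ ^ 2 -
        (g.inducedMetric f hpb hfi).normSq y₀ (g.secondFundamentalForm I' f ν y₀)) / ε := by
  haveI := (g.inducedMetric f hpb hfi).hasLeviCivita
  classical
  have hf2 : ContMDiff I' I 2 f :=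
    (IsSpacelikeImmersion.contMDiff_self hfi).of_le (by exact WithTop.coe_le_coe.2 le_top)
  have hdim : Module.finrank ℝ E = Module.finrank ℝ E' + 1 := by rw [hm, hm1]
  -- notation
  set gN := g.inducedMetric f hpb hfi with hgN
  set K := g.secondFundamentalForm I' f ν y₀ with hK
  -- an orthogonal basis `β` of `(T_{y₀} N, f^*g)` indexed by `Fin m`
  obtain ⟨e, he, hde⟩ := exists_isOrthoᵢ_basis gN y₀
  have hfin : Module.finrank ℝ (TangentSpace I' y₀) = m := hm
  set β : Module.Basis (Fin m) ℝ (TangentSpace I' y₀) := e.reindex (finCongr hfin) with hβdef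
  have hβapply : ∀ k, β k = e ((finCongr hfin).symm k) := fun k ↦ Module.Basis.reindex_apply _ _ _
  have hβ : (gN.toBilinForm y₀).IsOrthoᵢ β := by
    intro k l hkl
    simp only [Function.onFun, hβapply]
    exact he fun h ↦ hkl ((finCongr hfin).symm.injective h)
  have hdβ : ∀ k, gN.val y₀ (β k) (β k) ≠ 0 := fun k ↦ by
    rw [hβapply]; exact hde _
  set a : Fin m → ℝ := fun i ↦ gN.val y₀ (β i) (β i) with ha
  -- the Gauss equation on every pair, read at `y₀`
  have hG : ∀ i j : Fin m, gN.val y₀ (gN.riemann y₀ (β i) (β j) (β j)) (β i) =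
      g.val (f y₀) (g.riemann (f y₀) (mfderiv I' I f y₀ (β i)) (mfderiv I' I f y₀ (β j))
        (mfderiv I' I f y₀ (β j))) (mfderiv I' I f y₀ (β i)) +
      (K (β i) (β i) * K (β j) (β j) - K (β i) (β j) * K (β j) (β i)) / ε := fun i j ↦ by
    have h := gauss_equation_localFrame g hpb hfi (b' := β) (y₀ := y₀) hν hun hε hdim i j
    simp only [localFrame_trivializationAt_self] at h
    exact h
  -- symmetry of `K`
  have hKs : ∀ v w, K v w = K w v := fun v w ↦
    ((secondFundamentalForm_symm_holds (g := g) (I' := I') hf2 hun.1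
      (hν.of_le (by exact WithTop.coe_le_coe.2 le_top)) BoundarylessManifold.isInteriorPoint).eq
        v w)
  -- the scalar curvature of `N`
  have hSN := scalarCurvature_eq_sum_of_isOrthoᵢ gN y₀ β hβ hdβ
  -- the adapted orthogonal basis `(df β₀, …, df βₘ₋₁, ν)` of `T_{f y₀} M`
  have hn0 : ∀ k, g.val (f y₀) (mfderiv I' I f y₀ (β k)) (ν y₀) = 0 := fun k ↦ by
    rw [g.symm]; exact hun.1 y₀ (β k)
  have hνε : g.val (f y₀) (ν y₀) (ν y₀) = ε := hun.2 y₀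
  set v : Fin (m + 1) → TangentSpace I (f y₀) :=
    Fin.snoc (α := fun _ ↦ TangentSpace I (f y₀)) (fun i ↦ mfderiv I' I f y₀ (β i)) (ν y₀)
    with hv
  have hvc : ∀ i : Fin m, v i.castSucc = mfderiv I' I f y₀ (β i) := fun i ↦ by
    simp [hv]
  have hvl : v (Fin.last m) = ν y₀ := by simp [hv]
  have hvo : (g.toBilinForm (f y₀)).IsOrthoᵢ v := by
    intro k l hkl
    simp only [Function.onFun, toBilinForm_apply]
    induction k using Fin.lastCases with
    | last =>
      induction l using Fin.lastCases with
      | last => exact absurd rfl hkl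
      | cast j => rw [hvl, hvc, g.symm]; exact hn0 j
    | cast i =>
      induction l using Fin.lastCases with
      | last => rw [hvl, hvc]; exact hn0 i
      | cast j =>
        rw [hvc, hvc]
        exact hβ fun h ↦ hkl (by rw [h])
  have hvd : ∀ k, g.toBilinForm (f y₀) (v k) (v k) ≠ 0 := by
    intro k
    induction k using Fin.lastCases with
    | last => rw [toBilinForm_apply, hvl, hνε]; exact hε
    | cast i => rw [toBilinForm_apply, hvc]; exact hdβ i
  have hli : LinearIndependent ℝ v := LinearMap.linearIndependent_of_isOrthoᵢ hvo hvd
  haveI : FiniteDimensional ℝ (TangentSpace I (f y₀)) := inferInstanceAs (FiniteDimensional ℝ E)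
  have hcard : Fintype.card (Fin (m + 1)) = Module.finrank ℝ (TangentSpace I (f y₀)) := by
    show Fintype.card (Fin (m + 1)) = Module.finrank ℝ E
    rw [hm1, Fintype.card_fin]
  set γ := basisOfLinearIndependentOfCardEqFinrank hli hcard with hγdef
  have hγ : ∀ k, γ k = v k := fun k ↦
    congrFun (coe_basisOfLinearIndependentOfCardEqFinrank hli hcard) k
  have hγo : (g.toBilinForm (f y₀)).IsOrthoᵢ γ := by
    intro k l hkl
    simp only [Function.onFun, hγ]
    exact hvo hkl
  have hSM := scalarCurvature_sub_ricci_eq_sum_of_isOrthoᵢ g (f y₀) γ hγo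
    (fun k ↦ by rw [hγ]; exact hvd k)
  simp only [hγ, hvc, hvl, hνε] at hSM
  -- the metric coefficients `aₖ = (f^*g)(βₖ, βₖ) = g(df βₖ, df βₖ)`
  have ha' : ∀ k, g.val (f y₀) (mfderiv I' I f y₀ (β k)) (mfderiv I' I f y₀ (β k)) = a k :=
    fun k ↦ rfl
  simp only [ha'] at hSM
  -- `H` and `|K|²` in the orthogonal frame
  have hH : g.meanCurvature f hpb hfi ν y₀ = ∑ i, K (β i) (β i) / a i := by
    rw [meanCurvature, trace_eq_sum_gram_inv _ y₀ β, gram_inv_of_isOrthoᵢ _ y₀ β hβ hdβ]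
    refine Finset.sum_congr rfl fun i _ ↦ ?_
    rw [Finset.sum_eq_single i]
    · rw [Matrix.diagonal_apply_eq, inv_mul_eq_div]
    · intro j _ hji
      rw [Matrix.diagonal_apply_ne _ hji, zero_mul]
    · intro h
      exact absurd (Finset.mem_univ i) h
  have hA : gN.normSq y₀ K = ∑ i, ∑ j, K (β j) (β i) ^ 2 / (a i * a j) :=
    normSq_eq_sum_sq gN y₀ β hβ hdβ K
  -- assemble: everything is a double sum over `Fin m × Fin m`
  have hSM' : g.scalarCurvature (f y₀) - 2 * g.ricci (f y₀) (ν y₀) (ν y₀) / ε =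
      ∑ k : Fin m, ∑ i : Fin m,
        g.val (f y₀) (g.riemann (f y₀) (mfderiv I' I f y₀ (β i)) (mfderiv I' I f y₀ (β k))
          (mfderiv I' I f y₀ (β k))) (mfderiv I' I f y₀ (β i)) / (a i * a k) := hSM
  have hH2 : g.meanCurvature f hpb hfi ν y₀ ^ 2 =
      ∑ k : Fin m, ∑ i : Fin m, K (β i) (β i) / a i * (K (β k) (β k) / a k) := by
    rw [hH, sq, Finset.sum_mul_sum, Finset.sum_comm]
  have hA' : gN.normSq y₀ K = ∑ k : Fin m, ∑ i : Fin m, K (β i) (β k) ^ 2 / (a i * a k) := by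
    rw [hA]
    refine Finset.sum_congr rfl fun k _ ↦ Finset.sum_congr rfl fun i _ ↦ ?_
    rw [hKs (β i) (β k), mul_comm (a k) (a i)]
  calc gN.scalarCurvature y₀
      = ∑ k : Fin m, ∑ i : Fin m, gN.val y₀ (gN.riemann y₀ (β i) (β k) (β k)) (β i) /
          (a i * a k) := hSN
    _ = ∑ k : Fin m, ∑ i : Fin m,
          (g.val (f y₀) (g.riemann (f y₀) (mfderiv I' I f y₀ (β i)) (mfderiv I' I f y₀ (β k))
            (mfderiv I' I f y₀ (β k))) (mfderiv I' I f y₀ (β i)) / (a i * a k) +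
          ((K (β i) (β i) / a i * (K (β k) (β k) / a k) - K (β i) (β k) ^ 2 / (a i * a k)) / ε)) := by
        refine Finset.sum_congr rfl fun k _ ↦ Finset.sum_congr rfl fun i _ ↦ ?_
        rw [hG i k, hKs (β k) (β i)]
        have hai := hdβ i
        have hak := hdβ k
        field_simp
    _ = g.scalarCurvature (f y₀) - 2 * g.ricci (f y₀) (ν y₀) (ν y₀) / ε +
        (g.meanCurvature f hpb hfi ν y₀ ^ 2 - gN.normSq y₀ K) / ε := by
        rw [hSM', hH2, hA', ← Finset.sum_sub_distrib, Finset.sum_div, ← Finset.sum_add_distrib]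
        refine Finset.sum_congr rfl fun k _ ↦ ?_
        rw [← Finset.sum_sub_distrib, Finset.sum_div, ← Finset.sum_add_distrib]

/-- **Riemannian form** (`ε = 1`, the case of a two-sided hypersurface in a Riemannian manifold,
e.g. the level sets `N_t` of the distance to the boundary in Bär–Hanke §3):
`S_g(f y₀) = S_{f^*g}(y₀) + 2 Ric_g(ν,ν) − H² + |K|²`. With `g = dt² + g_t`, `K = ½ ġ_t` and the
Riccati equation this is formula (9) of Bär–Hanke (Bär–Gauduchon–Moroianu 2005, Prop. 4.1).
[cite: ONeill1983, Ch. 4, Thm. 5 and Corollary] -/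
theorem scalarCurvature_eq_of_inducedMetric_general
    (hν : ContMDiff I' I.tangent ∞ (fun x ↦ (TotalSpace.mk' E (f x) (ν x) : TangentBundle I M)))
    (hun : g.IsUnitNormal I' f ν 1) {m : ℕ}
    (hm : Module.finrank ℝ E' = m) (hm1 : Module.finrank ℝ E = m + 1) (y₀ : N) :
    haveI := (g.inducedMetric f hpb hfi).hasLeviCivita
    g.scalarCurvature (f y₀) =
      (g.inducedMetric f hpb hfi).scalarCurvature y₀ + 2 * g.ricci (f y₀) (ν y₀) (ν y₀) -
      g.meanCurvature f hpb hfi ν y₀ ^ 2 +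
        (g.inducedMetric f hpb hfi).normSq y₀ (g.secondFundamentalForm I' f ν y₀) := by
  have h := scalarCurvature_inducedMetric_eq_general g hpb hfi hν hun one_ne_zero hm hm1 y₀
  simp only [div_one] at h
  linarith

end Traced

end PseudoRiemannianMetric

end Literature.Geometry.Lorentzian

end
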